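import Literature.Computability.Complexity.NegacyclicFFTBatch
import Literature.Computability.Complexity.StackFFTPasses
import HarnessLib

/-!
# The overlap-add pass of the fast negacyclic multiplier

Literature / complexity toolkit, continuing `StackFFTPasses.lean`.  The last batch pass of the
stack machine executing `negMulRec` (`NegacyclicFFT.lean`) breadth-first: after the inverse
transform, each instance's `t` blocks of length `2m` are reassembled into one block of length
`mt` modulo `x^{mt} + 1` — digit `σ` is `low_σ + high_{σ−1}`, digit `0` is `low_0 − high_{t−1}`
(`NegFFT.overlapAdd`).  The machine reads the blocks of an instance in REVERSE order (after the
item-reverse pass of `StackFFTPasses.lean`), keeps the previous low half in `L1`, and prepends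
each digit to the result block in `HOLD2` (pour via `TMP`), so the block comes out in order:

* the list-level recursion `oaLoop` / `oaResult` on the arrivals and **`oaResult_reverse`**:
  `oaResult N m Cs.reverse = NegFFT.overlapAdd N m Cs` (`oaLoop_reverse`,
  `oaLoop_append_singleton`, `oaLoop_valid`);
* programs `oaSplit` (read a block, move its low half onto `SACC` entry by entry), `oaFirst`,
  `oaStep`, `oaLast`, `oaInstance`, `oaPass`, the invariant `OAInv`, costs, and the run lemmas
  **`runs_oaSplit`**, **`runs_oaFirst`**, **`runs_oaStep`**, **`runs_oaLast`**,
  **`runs_oaInstance`** (an instance of `t ≥ 1` arrivals is consumed and `oaResult` emitted as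
  one block) and **`runs_oaPass`** (all instances; results on `OUT`); cost linear in the data
  size times `(n+1)³`.

## References

* J. von zur Gathen, J. Gerhard, *Modern Computer Algebra*, 3rd ed., CUP 2013, §8.3 Alg. 8.20
  step 5 (reassembly modulo `x^{2n} + 1`). (Folklore material, fully proved here.)
-/

namespace Literature.Computability.Complexity

open _root_.Computability SProg

/-! ### The overlap-add recursion the machine runs (arrivals in reverse block order) -/

/-- The overlap-add loop on arrivals `C_{t-2}, …, C_0` (reverse order): state = (previous low
half, digits accumulated so far, most recent first). [folklore] -/
def oaLoop (N m : ℕ) : List ℕ → List (List ℕ) → List ℕ → List ℕ × List ℕ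
  | lp, [], acc => (lp, acc)
  | lp, C :: D, acc => oaLoop N m (C.take m) D (vaddMod N lp (C.drop m) ++ acc)

/-- The overlap-add of an instance from its arrivals `C_{t-1}, C_{t-2}, …, C_0`. [folklore] -/
def oaResult (N m : ℕ) : List (List ℕ) → List ℕ
  | [] => []
  | C :: D => vsubMod N (oaLoop N m (C.take m) D []).1 (C.drop m) ++ (oaLoop N m (C.take m) D []).2

/-- The digit of two consecutive blocks. [folklore] -/
abbrev oaG (N m : ℕ) (c c' : List ℕ) : List ℕ := vaddMod N (c.take m) (c'.drop m)

/-- `zipWith` over a nonempty list and its shift splits off the last pair. [folklore] -/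
theorem zipWith_tail_dropLast_concat (N m : ℕ) (E : List (List ℕ)) (hE : E ≠ []) (C : List ℕ) :
    List.zipWith (oaG N m) (E ++ [C]).tail (E ++ [C]).dropLast = List.zipWith (oaG N m) E.tail E.dropLast ++ [oaG N m C (E.getLast hE)] := by
  rw [List.tail_append_of_ne_nil hE, List.dropLast_concat]
  have hl : E.tail.length = E.dropLast.length := by rw [List.length_tail, List.length_dropLast]
  have key : ∀ E₀, E₀ = E.dropLast ++ [E.getLast hE] →
      List.zipWith (oaG N m) (E.tail ++ [C]) E₀ = List.zipWith (oaG N m) E.tail E.dropLast ++ [oaG N m C (E.getLast hE)] := by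
    rintro E₀ rfl; exact Com.zipWith_append_singleton _ _ _ _ _ hl
  exact key E (List.dropLast_append_getLast hE).symm

/-- The loop on the reversal of a nonempty prefix `E = [C_0, …, C_j]`. [folklore] -/
theorem oaLoop_reverse (N m : ℕ) (E : List (List ℕ)) (hE : E ≠ []) (lp acc : List ℕ) :
    oaLoop N m lp E.reverse acc =
      ((E.head hE).take m, (List.zipWith (oaG N m) E.tail E.dropLast).flatten ++ (vaddMod N lp ((E.getLast hE).drop m) ++ acc)) := by
  induction E using List.reverseRecOn generalizing lp acc with
  | nil => exact absurd rfl hE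
  | append_singleton E' C ih =>
    rw [List.reverse_append, List.reverse_singleton, List.singleton_append, oaLoop]
    rcases eq_or_ne E' [] with rfl | hE'
    · simp [oaLoop]
    · rw [ih hE', zipWith_tail_dropLast_concat N m E' hE' C, List.flatten_append, List.flatten_singleton,
        List.head_append_of_ne_nil hE']
      simp only [List.getLast_append_singleton, List.append_assoc]

/-- **The machine's overlap-add is `overlapAdd`**: on the arrivals in reverse block order.
[folklore] -/
theorem oaResult_reverse (N m : ℕ) (Cs : List (List ℕ)) (hCs : Cs ≠ []) :
    oaResult N m Cs.reverse = NegFFT.overlapAdd N m Cs := by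
  have hsplit := List.dropLast_append_getLast hCs
  set E := Cs.dropLast with hEdef
  set C := Cs.getLast hCs with hCdef
  have hrev : Cs.reverse = C :: E.reverse := by
    conv_lhs => rw [← hsplit]
    rw [List.reverse_append, List.reverse_singleton, List.singleton_append]
  rw [hrev, oaResult]
  unfold NegFFT.overlapAdd
  rw [List.getLastD_eq_getLast?, List.getLast?_eq_some_getLast hCs, Option.getD_some, ← hCdef]
  rcases eq_or_ne E [] with hE | hE
  · have hCs1 : Cs = [C] := by rw [← hsplit, hE, List.nil_append]
    rw [hE, List.reverse_nil, oaLoop, hCs1]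
    simp
  · rw [oaLoop_reverse N m E hE]
    have hhead : Cs.headD [] = E.head hE := by
      conv_lhs => rw [← hsplit]
      rw [List.headD_eq_head?_getD, List.head?_append, List.head?_eq_some_head hE]; rfl
    have hzip : List.zipWith (fun c c' => vaddMod N (List.take m c) (List.drop m c')) Cs.tail Cs.dropLast =
        List.zipWith (oaG N m) E.tail E.dropLast ++ [oaG N m C (E.getLast hE)] := by
      conv_lhs => rw [← hsplit]
      exact zipWith_tail_dropLast_concat N m E hE C
    rw [hhead, hzip, List.flatten_append, List.flatten_singleton, List.append_nil]

/-- `pushNums` from an empty accumulator is the reversed code. [folklore] -/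
theorem pushNums_nil_eq (c : List ℕ) : pushNums c [] = (encVec c).reverse := by
  have h := pushNums_outRev c []
  rw [List.map_nil, Com.outRev_nil, List.nil_append] at h
  rw [h, ← reverse_outRev_map, List.reverse_reverse]

/-- `oaLoop` after one more arrival. [folklore] -/
theorem oaLoop_append_singleton (N m : ℕ) : ∀ (lp : List ℕ) (D : List (List ℕ)) (C acc : List ℕ),
    oaLoop N m lp (D ++ [C]) acc = (C.take m, vaddMod N (oaLoop N m lp D acc).1 (C.drop m) ++ (oaLoop N m lp D acc).2)
  | lp, [], C, acc => by simp [oaLoop]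
  | lp, C' :: D, C, acc => by rw [List.cons_append, oaLoop, oaLoop, oaLoop_append_singleton]

/-- Entries of the `oaLoop` state stay reduced and of length `m`. [folklore] -/
theorem oaLoop_valid {N m : ℕ} (hN : 0 < N) : ∀ (lp : List ℕ) (D : List (List ℕ)) (acc : List ℕ),
    (lp.length = m ∧ ∀ a ∈ lp, a < N) → (∀ C ∈ D, C.length = 2 * m ∧ ∀ a ∈ C, a < N) → (∀ a ∈ acc, a < N) →
      ((oaLoop N m lp D acc).1.length = m ∧ ∀ a ∈ (oaLoop N m lp D acc).1, a < N) ∧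
        (oaLoop N m lp D acc).2.length = acc.length + m * D.length ∧ ∀ a ∈ (oaLoop N m lp D acc).2, a < N
  | lp, [], acc, hlp, _, hacc => by refine ⟨?_, ?_, ?_⟩ <;> simp [oaLoop, hlp.1] <;> first | exact hlp.2 | exact hacc
  | lp, C :: D, acc, hlp, hD, hacc => by
    have hC := hD C (by simp)
    rw [oaLoop]
    have h1 : (C.take m).length = m ∧ ∀ a ∈ C.take m, a < N :=
      ⟨by rw [List.length_take, hC.1]; omega, fun a ha => hC.2 a (List.mem_of_mem_take ha)⟩
    have h2 : ∀ a ∈ vaddMod N lp (C.drop m) ++ acc, a < N := by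
      intro a ha; rw [List.mem_append] at ha
      rcases ha with ha | ha
      · exact lt_of_mem_vaddMod hN ha
      · exact hacc a ha
    have ih := oaLoop_valid hN (C.take m) D _ h1 (fun C' hC' => hD C' (by simp [hC'])) h2
    refine ⟨ih.1, ?_, ih.2.2⟩
    rw [ih.2.1, List.length_append, length_vaddMod, hlp.1, List.length_drop, hC.1, List.length_cons]
    rw [show 2 * m - m = m by omega, min_self]; ring

namespace Com

variable {β : Type} [DecidableEq β] (q : FReg ↪ β)

/-! ### The overlap-add pass -/

/-- Read the next block into `X2` and move its low half (first `m` entries, `m` in `HN`) onto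
`SACC` as numeral items; the high half stays in `X2`. [folklore] -/
def oaSplit : Com (EReg ⊕ β) :=
  readItemTo (Sum.inr (q .IN)) (Sum.inr (q .X2)) (vr (rVF q) .W) (vr (rVF q) .TT) ;;
  (nToUnary (rVF q .U) (q .HN) ;; countLoop (vr (rVF q) .U) (digEntryMove q))

/-- The first arrival `C_{t-1}`: its high half goes to `TW`, its low half to `L1`. [folklore] -/
def oaFirst : Com (EReg ⊕ β) :=
  oaSplit q ;; (move (Sum.inr (q .X2)) (Sum.inr (q .TW)) (ra .s) ;; pour (Sum.inr (q .SACC)) (vr (rVF q) .L1))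

/-- A middle arrival `C_σ`: digit `σ+1 = low_{σ+1} + high_σ` is computed (`L1` holds `low_{σ+1}`)
and prepended to the result block in `HOLD2`; then `L1 := low_σ`. [folklore] -/
def oaStep : Com (EReg ⊕ β) :=
  oaSplit q ;; (move (Sum.inr (q .X2)) (vr (rVF q) .L2) (ra .s) ;; (vAddMod (rVF q) ;;
  (pour (vr (rVF q) .DST) (Sum.inr (q .TMP)) ;; (pour (Sum.inr (q .TMP)) (Sum.inr (q .HOLD2)) ;;
  pour (Sum.inr (q .SACC)) (vr (rVF q) .L1)))))

/-- The last digit `0 = low_0 − high_{t-1}` (high half saved in `TW`), prepended; the result block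
is emitted onto `OACC`. [folklore] -/
def oaLast : Com (EReg ⊕ β) :=
  move (Sum.inr (q .TW)) (vr (rVF q) .L2) (ra .s) ;; (vSubMod (rVF q) ;;
  (pour (vr (rVF q) .DST) (Sum.inr (q .TMP)) ;; (pour (Sum.inr (q .TMP)) (Sum.inr (q .HOLD2)) ;;
  emit (Sum.inr (q .HOLD2)) (Sum.inr (q .OACC)))))

/-- One instance: first arrival, `t − 1` middle arrivals (count `t` in `T1`, one token popped),
last digit. [folklore] -/
def oaInstance : Com (EReg ⊕ β) :=
  oaFirst q ;; (nToUnary (q .CNT) (q .T1) ;; (pop (Sum.inr (q .CNT)) skip skip skip ;; (countLoop (Sum.inr (q .CNT)) (oaStep q) ;; oaLast q)))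

/-- The overlap-add pass: the instance loop over `IN`, then the result blocks are poured onto
`OUT`. [folklore] -/
def oaPass : Com (EReg ⊕ β) :=
  streamLoop (Sum.inr (q .IN)) (vr (rVF q) .W) (oaInstance q) ;; pour (Sum.inr (q .OACC)) (Sum.inr (q .OUT))

/-- The invariant of the overlap-add pass over the base file: modulus, half-length `m` in `HN`,
clean vector-pass scratch. [folklore] -/
def OAInv (N m : ℕ) (T : Regs β) : Prop :=
  T (q (.n (.v .MD))) = encodeNat N ∧ T (q .HN) = encodeNat m ∧
  T (q (.n (.v .A))) = [] ∧ T (q (.n (.v .B))) = [] ∧ T (q (.n (.v .D))) = [] ∧ T (q (.n (.v .F))) = [] ∧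
  T (q (.n (.v .W))) = [] ∧ T (q (.n (.v .TT))) = [] ∧ T (q (.n (.v .O))) = [] ∧ T (q (.n (.v .U))) = []

/-- Cost of `oaSplit`. [folklore] -/
def oaSplitCost (n m : ℕ) : ℕ := 75 * m * n + 21 * n + 14 * m + 15

/-- **`oaSplit`.** [folklore] -/
theorem runs_oaSplit {N n m : ℕ} (hn : (encodeNat N).length + 1 ≤ n) (hmn : (encodeNat m).length ≤ n) (T : Regs β)
    (hI : OAInv q N m T) (z : FSlots) {C : List ℕ} {rest : List (List ℕ)} (hC : C.length = 2 * m ∧ ∀ a ∈ C, a < N)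
    (hzin : z.inp = encBlocks (C :: rest)) (hzx1 : z.x1 = []) (hzx2 : z.x2 = []) :
    Runs (oaSplit q) (base (fSt q T z))
      (base (fSt q T { z with inp := encBlocks rest, x2 := encVec (C.drop m), sacc := pushNums (C.take m) z.sacc })) (oaSplitCost n m) := by
  have hq : ∀ {i j : FReg}, i ≠ j → q i ≠ q j := fun h => q.injective.ne h
  obtain ⟨-, hHN, -, -, -, -, hW, hTT, -, hU⟩ := hI
  have rdW : ∀ zz : FSlots, fSt q T zz (q (.n (.v .W))) = [] := fun zz => by rw [fSt_v q T zz] <;> first | decide | exact hW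
  have rdTT : ∀ zz : FSlots, fSt q T zz (q (.n (.v .TT))) = [] := fun zz => by rw [fSt_v q T zz] <;> first | decide | exact hTT
  have hU' : ∀ zz : FSlots, fSt q T zz (rVF q .U) = [] := fun zz => by
    simp only [rVF, Function.Embedding.trans_apply, NReg.ιV_apply, FReg.ιN_apply]
    rw [fSt_v q _ _ (by decide) (by decide) (by decide) (by decide)]; exact hU
  have hTo : ∀ (zz : FSlots) (k : ℕ), Function.update (fSt q T zz) (rVF q .U) (List.replicate k true) =
      fSt q (Function.update T (q (.n (.v .U))) (List.replicate k true)) zz := fun zz k => by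
    simp only [rVF, Function.Embedding.trans_apply, NReg.ιV_apply, FReg.ιN_apply]
    rw [fSt_update_v q _ _ (by decide) (by decide) (by decide) (by decide)]
  have hlC : (encVec C).length ≤ 2 * m * (2 * n) := by have := length_encVec_le_of_lt hC.2 hn; rwa [hC.1] at this
  have hlt : (C.take m).length = m := by rw [List.length_take, hC.1]; omega
  let z1 : FSlots := { z with inp := encBlocks rest, x2 := encVec C }
  have h1 : Runs (readItemTo (Sum.inr (q .IN)) (Sum.inr (q .X2)) (vr (rVF q) .W) (vr (rVF q) .TT)) (base (fSt q T z))
      (base (fSt q T z1)) (11 * (2 * m * (2 * n)) + 9) := by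
    refine (runs_readItemTo (by simp [hq]) (by simp [hq]) (by simp [hq]) (by simp [hq]) (by simp [hq]) (encVec C) (encBlocks rest)
      (base (fSt q T z)) (by simp [hzin, encBlocks_cons]) (by simp [rdW]) (by simp [rdTT])).of_eq (by simp [z1, hzx2]) ?_
    omega
  have h2 : Runs (nToUnary (rVF q .U) (q .HN)) (base (fSt q T z1))
      (base (fSt q (Function.update T (q (.n (.v .U))) (List.replicate m true)) z1)) (n * (16 * m + 21) + 5) := by
    refine (runs_nToUnary (rVF q .U) (q .HN) (fSt q T z1) (hU' z1)).of_eq (by rw [fSt_HN, hHN, bitsToNat_encodeNat, hTo]) ?_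
    simp only [fSt_HN, hHN, bitsToNat_encodeNat]
    exact Nat.add_le_add_right (Nat.mul_le_mul_right _ hmn) _
  have h3 := runs_digEntries q hn T hW hTT hU z1 (c := C.take m) (rest := C.drop m) (fun a ha => hC.2 a (List.mem_of_mem_take ha))
    (by simp [z1, List.take_append_drop]) (by simp [z1, hzx1])
  rw [hlt] at h3
  refine (h1.seq (h2.seq h3)).of_eq (by simp only [z1]) ?_
  unfold oaSplitCost; nlinarith

/-- Cost of `oaFirst`. [folklore] -/
def oaFirstCost (n m : ℕ) : ℕ := oaSplitCost n m + 18 * (m * n) + 3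

/-- **`oaFirst`.** [folklore] -/
theorem runs_oaFirst {N n m : ℕ} (hn : (encodeNat N).length + 1 ≤ n) (hmn : (encodeNat m).length ≤ n) (T : Regs β)
    (hI : OAInv q N m T) (z : FSlots) {C : List ℕ} {rest : List (List ℕ)} (hC : C.length = 2 * m ∧ ∀ a ∈ C, a < N)
    (hzin : z.inp = encBlocks (C :: rest)) (hzx1 : z.x1 = []) (hzx2 : z.x2 = []) (hztw : z.tw = []) (hzs : z.sacc = []) (hzl1 : z.l1 = []) :
    Runs (oaFirst q) (base (fSt q T z))
      (base (fSt q T { z with inp := encBlocks rest, tw := encVec (C.drop m), l1 := encVec (C.take m) })) (oaFirstCost n m) := by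
  have hq : ∀ {i j : FReg}, i ≠ j → q i ≠ q j := fun h => q.injective.ne h
  have hlh : (encVec (C.drop m)).length ≤ m * (2 * n) := by
    have := length_encVec_le_of_lt (v := C.drop m) (fun a ha => hC.2 a (List.mem_of_mem_drop ha)) hn
    rw [List.length_drop, hC.1, show 2 * m - m = m by omega] at this; exact this
  have hll : (encVec (C.take m)).length ≤ m * (2 * n) := by
    have := length_encVec_le_of_lt (v := C.take m) (fun a ha => hC.2 a (List.mem_of_mem_take ha)) hn
    rw [List.length_take, hC.1, show min m (2 * m) = m by omega] at this; exact this
  let z1 : FSlots := { z with inp := encBlocks rest, x2 := encVec (C.drop m), sacc := pushNums (C.take m) [] }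
  let z2 : FSlots := { z with inp := encBlocks rest, x2 := [], sacc := pushNums (C.take m) [], tw := encVec (C.drop m) }
  let z3 : FSlots := { z with inp := encBlocks rest, x2 := [], sacc := [], tw := encVec (C.drop m), l1 := encVec (C.take m) }
  have h1 : Runs (oaSplit q) (base (fSt q T z)) (base (fSt q T z1)) (oaSplitCost n m) :=
    (runs_oaSplit q hn hmn T hI z hC hzin hzx1 hzx2).of_eq (by simp [z1, hzs]) le_rfl
  have h2 : Runs (move (Sum.inr (q .X2)) (Sum.inr (q .TW)) (ra .s)) (base (fSt q T z1)) (base (fSt q T z2)) (6 * (m * (2 * n)) + 2) := by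
    refine (runs_omove (a := q .X2) (b := q .TW) (hq (by decide)) (fSt q T z1)).of_eq (by simp [z1, z2, hztw]) ?_
    simp only [fSt_X2, z1]; omega
  have h3 : Runs (pour (Sum.inr (q .SACC)) (vr (rVF q) .L1)) (base (fSt q T z2)) (base (fSt q T z3)) (3 * (m * (2 * n)) + 1) := by
    refine (runs_opour (a := q .SACC) (b := rVF q .L1) (by simp [hq]) (fSt q T z2)).of_eq ?_ ?_
    · simp [z2, z3, hzl1, pushNums_nil_eq]
    · simp only [fSt_SACC, z2, pushNums_nil_eq, List.length_reverse]; omega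
  refine (h1.seq (h2.seq h3)).of_eq (by simp only [z3, hzx2, hzs]) ?_
  unfold oaFirstCost; nlinarith

/-- Cost of `oaStep`. [folklore] -/
def oaStepCost (n m : ℕ) : ℕ := oaSplitCost n m + vArithCost n m + 30 * (m * n) + 5

/-- **`oaStep`.** [folklore] -/
theorem runs_oaStep {N n m : ℕ} (hn : (encodeNat N).length + 1 ≤ n) (hmn : (encodeNat m).length ≤ n) (T : Regs β)
    (hI : OAInv q N m T) (z : FSlots) {C lp acc : List ℕ} {rest : List (List ℕ)} (hC : C.length = 2 * m ∧ ∀ a ∈ C, a < N)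
    (hlp : lp.length = m ∧ ∀ a ∈ lp, a < N)
    (hzin : z.inp = encBlocks (C :: rest)) (hzx1 : z.x1 = []) (hzx2 : z.x2 = []) (hzs : z.sacc = []) (hzl1 : z.l1 = encVec lp)
    (hzl2 : z.l2 = []) (hzd : z.dst = []) (hzt : z.tmp = []) (hzh2 : z.hold2 = encVec acc) :
    Runs (oaStep q) (base (fSt q T z))
      (base (fSt q T { z with inp := encBlocks rest, l1 := encVec (C.take m), hold2 := encVec (vaddMod N lp (C.drop m) ++ acc) })) (oaStepCost n m) := by
  have hq : ∀ {i j : FReg}, i ≠ j → q i ≠ q j := fun h => q.injective.ne h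
  have hI' := hI
  obtain ⟨hMD, -, hA, hB, hD, hF, hW, hTT, hO, -⟩ := hI'
  have rd : ∀ (zz : FSlots) (x : VReg), x ≠ .E → x ≠ .L1 → x ≠ .L2 → x ≠ .DST →
      fSt q T zz (q (.n (.v x))) = T (q (.n (.v x))) := fun zz x h1 h2 h3 h4 => fSt_v q T zz h1 h2 h3 h4
  have hN : 0 < N ∨ m = 0 := by
    rcases lp with _ | ⟨a, _⟩
    · right; simpa using hlp.1.symm
    · left; exact (Nat.zero_le a).trans_lt (hlp.2 a (by simp))
  have hhi : (C.drop m).length = m ∧ ∀ a ∈ C.drop m, a < N :=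
    ⟨by rw [List.length_drop, hC.1]; omega, fun a ha => hC.2 a (List.mem_of_mem_drop ha)⟩
  have hlo : (C.take m).length = m ∧ ∀ a ∈ C.take m, a < N :=
    ⟨by rw [List.length_take, hC.1]; omega, fun a ha => hC.2 a (List.mem_of_mem_take ha)⟩
  set d := vaddMod N lp (C.drop m) with hd
  have hdv : d.length = m ∧ ∀ a ∈ d, a < N := by
    refine ⟨by rw [hd, length_vaddMod, hlp.1, hhi.1, min_self], fun a ha => ?_⟩
    rcases hN with hN | hm
    · exact lt_of_mem_vaddMod hN ha
    · exfalso; have : d.length = 0 := by rw [hd, length_vaddMod, hlp.1, hm, Nat.zero_min]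
      rw [List.length_eq_zero_iff] at this; rw [this] at ha; simp at ha
  have hlh : (encVec (C.drop m)).length ≤ m * (2 * n) := by have := length_encVec_le_of_lt hhi.2 hn; rwa [hhi.1] at this
  have hll : (encVec (C.take m)).length ≤ m * (2 * n) := by have := length_encVec_le_of_lt hlo.2 hn; rwa [hlo.1] at this
  have hld : (encVec d).length ≤ m * (2 * n) := by have := length_encVec_le_of_lt hdv.2 hn; rwa [hdv.1] at this
  let z1 : FSlots := { z with inp := encBlocks rest, x2 := encVec (C.drop m), sacc := pushNums (C.take m) [] }
  let z2 : FSlots := { z with inp := encBlocks rest, x2 := [], sacc := pushNums (C.take m) [], l2 := encVec (C.drop m) }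
  let z3 : FSlots := { z with inp := encBlocks rest, x2 := [], sacc := pushNums (C.take m) [], l1 := [], l2 := [], dst := encVec d }
  let z4 : FSlots := { z with inp := encBlocks rest, x2 := [], sacc := pushNums (C.take m) [], l1 := [], l2 := [], dst := [], tmp := (encVec d).reverse }
  let z5 : FSlots := { z with inp := encBlocks rest, x2 := [], sacc := pushNums (C.take m) [], l1 := [], l2 := [], dst := [], tmp := [], hold2 := encVec d ++ encVec acc }
  let z6 : FSlots := { z with inp := encBlocks rest, x2 := [], sacc := [], l1 := encVec (C.take m), l2 := [], dst := [], tmp := [], hold2 := encVec d ++ encVec acc }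
  have h1 : Runs (oaSplit q) (base (fSt q T z)) (base (fSt q T z1)) (oaSplitCost n m) :=
    (runs_oaSplit q hn hmn T hI z hC hzin hzx1 hzx2).of_eq (by simp only [z1, hzs]) le_rfl
  have h2 : Runs (move (Sum.inr (q .X2)) (vr (rVF q) .L2) (ra .s)) (base (fSt q T z1)) (base (fSt q T z2)) (6 * (m * (2 * n)) + 2) := by
    refine (runs_omove (a := q .X2) (b := rVF q .L2) (by simp [hq]) (fSt q T z1)).of_eq (by simp [z1, z2, hzl2]) ?_
    simp only [fSt_X2, z1]; omega
  have h3 : Runs (vAddMod (rVF q)) (base (fSt q T z2)) (base (fSt q T z3)) (vArithCost n m) := by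
    have h := runs_vAddMod (rVF q) hn (fSt q T z2) (u := lp) (v := C.drop m) (by rw [hlp.1, hhi.1]) hlp.2 hhi.2 (by simp [z2, hzl1])
      (by simp [z2]) (by simp [rd _ .MD, hMD]) (by simp [rd _ .A, hA]) (by simp [rd _ .B, hB]) (by simp [rd _ .D, hD])
      (by simp [rd _ .F, hF]) (by simp [rd _ .W, hW]) (by simp [rd _ .TT, hTT]) (by simp [rd _ .O, hO])
    rw [hlp.1] at h
    exact h.of_eq (by simp [z2, z3, hzd, hd]) le_rfl
  have h4 : Runs (pour (vr (rVF q) .DST) (Sum.inr (q .TMP))) (base (fSt q T z3)) (base (fSt q T z4)) (3 * (m * (2 * n)) + 1) := by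
    refine (runs_opour (a := rVF q .DST) (b := q .TMP) (by simp [hq]) (fSt q T z3)).of_eq (by simp [z3, z4, hzt]) ?_
    simp only [z3]; rw [show fSt q T _ (rVF q .DST) = encVec d by simp]; omega
  have h5 : Runs (pour (Sum.inr (q .TMP)) (Sum.inr (q .HOLD2))) (base (fSt q T z4)) (base (fSt q T z5)) (3 * (m * (2 * n)) + 1) := by
    refine (runs_opour (a := q .TMP) (b := q .HOLD2) (hq (by decide)) (fSt q T z4)).of_eq (by simp [z4, z5, hzh2]) ?_
    simp only [fSt_TMP, z4, List.length_reverse]; omega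
  have h6 : Runs (pour (Sum.inr (q .SACC)) (vr (rVF q) .L1)) (base (fSt q T z5)) (base (fSt q T z6)) (3 * (m * (2 * n)) + 1) := by
    refine (runs_opour (a := q .SACC) (b := rVF q .L1) (by simp [hq]) (fSt q T z5)).of_eq ?_ ?_
    · simp [z5, z6, pushNums_nil_eq]
    · simp only [fSt_SACC, z5, pushNums_nil_eq, List.length_reverse]; omega
  refine (h1.seq (h2.seq (h3.seq (h4.seq (h5.seq h6))))).of_eq ?_ ?_
  · simp only [z6, hzx2, hzs, hzl2, hzd, hzt, encVec_append]
  · unfold oaStepCost; nlinarith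

/-- Cost of `oaLast`. [folklore] -/
def oaLastCost (n m K : ℕ) : ℕ := vArithCost n m + 24 * (m * n) + 8 * (K * n) + 8

/-- **`oaLast`.** [folklore] -/
theorem runs_oaLast {N n m : ℕ} (hn : (encodeNat N).length + 1 ≤ n) (T : Regs β) (hI : OAInv q N m T) (z : FSlots)
    {hl lp acc : List ℕ} (hhl : hl.length = m ∧ ∀ a ∈ hl, a < N) (hlp : lp.length = m ∧ ∀ a ∈ lp, a < N) (hacc : ∀ a ∈ acc, a < N)
    (hztw : z.tw = encVec hl) (hzl1 : z.l1 = encVec lp) (hzl2 : z.l2 = []) (hzd : z.dst = []) (hzt : z.tmp = []) (hzh2 : z.hold2 = encVec acc) :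
    Runs (oaLast q) (base (fSt q T z))
      (base (fSt q T { z with tw := [], l1 := [], hold2 := [], oacc := pushItem (vsubMod N lp hl ++ acc) z.oacc }))
      (oaLastCost n m (m + acc.length)) := by
  have hq : ∀ {i j : FReg}, i ≠ j → q i ≠ q j := fun h => q.injective.ne h
  obtain ⟨hMD, -, hA, hB, hD, hF, hW, hTT, hO, -⟩ := hI
  have rd : ∀ (zz : FSlots) (x : VReg), x ≠ .E → x ≠ .L1 → x ≠ .L2 → x ≠ .DST →
      fSt q T zz (q (.n (.v x))) = T (q (.n (.v x))) := fun zz x h1 h2 h3 h4 => fSt_v q T zz h1 h2 h3 h4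
  have hN : 0 < N ∨ m = 0 := by
    rcases lp with _ | ⟨a, _⟩
    · right; simpa using hlp.1.symm
    · left; exact (Nat.zero_le a).trans_lt (hlp.2 a (by simp))
  set d := vsubMod N lp hl with hd
  have hdv : d.length = m ∧ ∀ a ∈ d, a < N := by
    refine ⟨by rw [hd, length_vsubMod, hlp.1, hhl.1, min_self], fun a ha => ?_⟩
    rcases hN with hN | hm
    · exact lt_of_mem_vsubMod hN ha
    · exfalso; have : d.length = 0 := by rw [hd, length_vsubMod, hlp.1, hm, Nat.zero_min]
      rw [List.length_eq_zero_iff] at this; rw [this] at ha; simp at ha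
  have hlhl : (encVec hl).length ≤ m * (2 * n) := by have := length_encVec_le_of_lt hhl.2 hn; rwa [hhl.1] at this
  have hld : (encVec d).length ≤ m * (2 * n) := by have := length_encVec_le_of_lt hdv.2 hn; rwa [hdv.1] at this
  have hlda : (encVec (d ++ acc)).length ≤ (m + acc.length) * (2 * n) := by
    have := length_encVec_le_of_lt (v := d ++ acc) (fun a ha => by
      rw [List.mem_append] at ha; rcases ha with ha | ha; exacts [hdv.2 a ha, hacc a ha]) hn
    rwa [List.length_append, hdv.1] at this
  let z1 : FSlots := { z with tw := [], l2 := encVec hl }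
  let z2 : FSlots := { z with tw := [], l1 := [], l2 := [], dst := encVec d }
  let z3 : FSlots := { z with tw := [], l1 := [], l2 := [], dst := [], tmp := (encVec d).reverse }
  let z4 : FSlots := { z with tw := [], l1 := [], l2 := [], dst := [], tmp := [], hold2 := encVec (d ++ acc) }
  let z5 : FSlots := { z with tw := [], l1 := [], l2 := [], dst := [], tmp := [], hold2 := [], oacc := pushItem (d ++ acc) z.oacc }
  have h1 : Runs (move (Sum.inr (q .TW)) (vr (rVF q) .L2) (ra .s)) (base (fSt q T z)) (base (fSt q T z1)) (6 * (m * (2 * n)) + 2) := by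
    refine (runs_omove (a := q .TW) (b := rVF q .L2) (by simp [hq]) (fSt q T z)).of_eq (by simp [z1, hztw, hzl2]) ?_
    simp only [fSt_TW, hztw]; omega
  have h2 : Runs (vSubMod (rVF q)) (base (fSt q T z1)) (base (fSt q T z2)) (vArithCost n m) := by
    have h := runs_vSubMod (rVF q) hn (fSt q T z1) (u := lp) (v := hl) (by rw [hlp.1, hhl.1]) hlp.2 hhl.2 (by simp [z1, hzl1])
      (by simp [z1]) (by simp [rd _ .MD, hMD]) (by simp [rd _ .A, hA]) (by simp [rd _ .B, hB]) (by simp [rd _ .D, hD])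
      (by simp [rd _ .F, hF]) (by simp [rd _ .W, hW]) (by simp [rd _ .TT, hTT]) (by simp [rd _ .O, hO])
    rw [hlp.1] at h
    exact h.of_eq (by simp [z1, z2, hzd, hd]) le_rfl
  have h3 : Runs (pour (vr (rVF q) .DST) (Sum.inr (q .TMP))) (base (fSt q T z2)) (base (fSt q T z3)) (3 * (m * (2 * n)) + 1) := by
    refine (runs_opour (a := rVF q .DST) (b := q .TMP) (by simp [hq]) (fSt q T z2)).of_eq (by simp [z2, z3, hzt]) ?_
    simp only [z2]; rw [show fSt q T _ (rVF q .DST) = encVec d by simp]; omega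
  have h4 : Runs (pour (Sum.inr (q .TMP)) (Sum.inr (q .HOLD2))) (base (fSt q T z3)) (base (fSt q T z4)) (3 * (m * (2 * n)) + 1) := by
    refine (runs_opour (a := q .TMP) (b := q .HOLD2) (hq (by decide)) (fSt q T z3)).of_eq (by simp [z3, z4, hzh2, encVec_append]) ?_
    simp only [fSt_TMP, z3, List.length_reverse]; omega
  have h5 : Runs (emit (Sum.inr (q .HOLD2)) (Sum.inr (q .OACC))) (base (fSt q T z4)) (base (fSt q T z5)) (4 * ((m + acc.length) * (2 * n)) + 3) := by
    refine (runs_emit (h := Sum.inr (q .HOLD2)) (o := Sum.inr (q .OACC)) (by simp [hq]) _).of_eq ?_ ?_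
    · simp [z4, z5, pushItem, dbl]
    · simp only [nst_inr, fSt_HOLD2, z4]; omega
  refine (h1.seq (h2.seq (h3.seq (h4.seq h5)))).of_eq (by simp only [z5, hd, hzt, hzl2, hzd]) ?_
  unfold oaLastCost; nlinarith

/-- Cost of one instance of `t` arrivals. [folklore] -/
def oaInstCost (n m t : ℕ) : ℕ := oaFirstCost n m + t * (oaStepCost n m + 2) + oaLastCost n m (m * t) + 16 * t * n + 21 * n + 8

/-- **One instance of the overlap-add.** With the `t ≥ 1` arrivals `C :: D'` (blocks of length `2m`,
reverse block order) at the head of `IN`, `t` in `T1` and clean slots, the instance is consumed and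
`oaResult N m (C :: D')` is emitted as one block onto `OACC`. [folklore] -/
theorem runs_oaInstance {N n m t : ℕ} (hn : (encodeNat N).length + 1 ≤ n) (hmn : (encodeNat m).length ≤ n)
    (htn : (encodeNat t).length ≤ n) (T : Regs β) (hI : OAInv q N m T) (z : FSlots)
    {C : List ℕ} {D' rest : List (List ℕ)} (hD : ∀ B ∈ C :: D', B.length = 2 * m ∧ ∀ a ∈ B, a < N) (hlen : D'.length + 1 = t)
    (hzin : z.inp = encBlocks (C :: D' ++ rest)) (hzt1 : z.t1 = encodeNat t) (hzx1 : z.x1 = []) (hzx2 : z.x2 = [])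
    (hzs : z.sacc = []) (hztw : z.tw = []) (hzl1 : z.l1 = []) (hzl2 : z.l2 = []) (hzd : z.dst = []) (hzt : z.tmp = [])
    (hzh2 : z.hold2 = []) (hzc : z.cnt = []) :
    Runs (oaInstance q) (base (fSt q T z))
      (base (fSt q T { z with inp := encBlocks rest, oacc := pushItem (oaResult N m (C :: D')) z.oacc })) (oaInstCost n m t) := by
  have hq : ∀ {i j : FReg}, i ≠ j → q i ≠ q j := fun h => q.injective.ne h
  have hC := hD C (by simp)
  have hD' : ∀ B ∈ D', B.length = 2 * m ∧ ∀ a ∈ B, a < N := fun B hB => hD B (by simp [hB])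
  have hN : 0 < N ∨ m = 0 := by
    rcases C with _ | ⟨a, _⟩
    · right; have := hC.1; simp at this; omega
    · left; exact (Nat.zero_le a).trans_lt (hC.2 a (by simp))
  have hlo : (C.take m).length = m ∧ ∀ a ∈ C.take m, a < N :=
    ⟨by rw [List.length_take, hC.1]; omega, fun a ha => hC.2 a (List.mem_of_mem_take ha)⟩
  have hhi : (C.drop m).length = m ∧ ∀ a ∈ C.drop m, a < N :=
    ⟨by rw [List.length_drop, hC.1]; omega, fun a ha => hC.2 a (List.mem_of_mem_drop ha)⟩
  -- validity of the loop states
  have hval : ∀ D₁, (∀ B ∈ D₁, B ∈ D') → ((oaLoop N m (C.take m) D₁ []).1.length = m ∧ ∀ a ∈ (oaLoop N m (C.take m) D₁ []).1, a < N) ∧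
      (oaLoop N m (C.take m) D₁ []).2.length = m * D₁.length ∧ ∀ a ∈ (oaLoop N m (C.take m) D₁ []).2, a < N := by
    intro D₁ hsub
    rcases hN with hN | hm
    · have := oaLoop_valid hN (C.take m) D₁ [] hlo (fun B hB => hD' B (hsub B hB)) (by simp)
      simpa using this
    · -- degenerate `m = 0`: everything is empty
      subst hm
      have hlp0 : C.take 0 = [] := rfl
      have key : ∀ (D₁ : List (List ℕ)) (lp acc : List ℕ), lp = [] → acc = [] → (∀ B ∈ D₁, B ∈ D') → oaLoop N 0 lp D₁ acc = ([], []) := by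
        intro D₁; induction D₁ with
        | nil => intro lp acc h1 h2 _; simp [oaLoop, h1, h2]
        | cons B D₁ ih =>
          intro lp acc h1 h2 hs
          rw [oaLoop]
          have hB : B = [] := List.eq_nil_of_length_eq_zero (by have := (hD' B (hs B (by simp))).1; omega)
          exact ih _ _ rfl (by subst h1; subst h2; subst hB; simp [vaddMod]) (fun B' hB' => hs B' (by simp [hB']))
      rw [key D₁ _ _ hlp0 rfl hsub]; simp
  let st : ℕ → List (List ℕ) → List (List ℕ) → FSlots := fun k D₁ D₂ =>
    { z with inp := encBlocks (D₂ ++ rest), tw := encVec (C.drop m), l1 := encVec (oaLoop N m (C.take m) D₁ []).1,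
             hold2 := encVec (oaLoop N m (C.take m) D₁ []).2, cnt := List.replicate k true }
  let z1 : FSlots := { z with inp := encBlocks (D' ++ rest), tw := encVec (C.drop m), l1 := encVec (C.take m) }
  let z2 : FSlots := { z with inp := encBlocks (D' ++ rest), tw := encVec (C.drop m), l1 := encVec (C.take m), cnt := List.replicate t true }
  have h1 : Runs (oaFirst q) (base (fSt q T z)) (base (fSt q T z1)) (oaFirstCost n m) :=
    (runs_oaFirst q hn hmn T hI z hC (by rw [hzin, List.cons_append]) hzx1 hzx2 hztw hzs hzl1).of_eq rfl le_rfl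
  have h2 : Runs (nToUnary (q .CNT) (q .T1)) (base (fSt q T z1)) (base (fSt q T z2)) (n * (16 * t + 21) + 5) := by
    refine (runs_nToUnary (q .CNT) (q .T1) (fSt q T z1) (by simp [z1, hzc])).of_eq (by simp [z1, z2, hzt1]) ?_
    simp only [fSt_T1, z1, hzt1, bitsToNat_encodeNat]
    exact Nat.add_le_add_right (Nat.mul_le_mul_right _ htn) _
  have h3 : Runs (pop (Sum.inr (q .CNT)) skip skip skip) (base (fSt q T z2)) (base (fSt q T (st (t - 1) [] D'))) 2 := by
    refine (runs_pop1 (Sum.inr (q .CNT)) (base (fSt q T z2))).of_eq ?_ le_rfl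
    simp [z2, st, oaLoop, hzh2, show List.replicate t true = true :: List.replicate (t - 1) true by
      rw [← List.replicate_succ, show t - 1 + 1 = t by omega]]
  have h4 : Runs (countLoop (Sum.inr (q .CNT)) (oaStep q)) (base (fSt q T (st (t - 1) [] D'))) (base (fSt q T (st 0 D' [])))
      ((t - 1) * (oaStepCost n m + 2) + 1) := by
    have h := runs_countLoop (U := Sum.inr (q .CNT)) (body := oaStep q)
      (fun k R => ∃ D₁ D₂, D₁ ++ D₂ = D' ∧ D₂.length = k ∧ R = base (fSt q T (st k D₁ D₂))) (oaStepCost n m)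
      (by
        rintro k R ⟨D₁, D₂, hsplit, hk, rfl⟩ -
        obtain ⟨B, D₂', rfl⟩ : ∃ B t, D₂ = B :: t := by
          cases D₂ with
          | nil => simp at hk
          | cons B t => exact ⟨B, t, rfl⟩
        simp only [List.length_cons, Nat.add_right_cancel_iff] at hk
        have hsub : ∀ B' ∈ D₁, B' ∈ D' := fun B' hB' => by rw [← hsplit]; simp [hB']
        have hBv : B.length = 2 * m ∧ ∀ a ∈ B, a < N := hD' B (by rw [← hsplit]; simp)
        have e1 : Function.update (base (fSt q T (st (k + 1) D₁ (B :: D₂')))) (Sum.inr (q .CNT)) (List.replicate k true) =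
            base (fSt q T (st k D₁ (B :: D₂'))) := by simp [st]
        rw [e1]
        have hv := hval D₁ hsub
        have hb := runs_oaStep q hn hmn T hI (st k D₁ (B :: D₂')) (C := B) (lp := (oaLoop N m (C.take m) D₁ []).1)
          (acc := (oaLoop N m (C.take m) D₁ []).2) (rest := D₂' ++ rest) hBv hv.1 (by simp [st]) (by simp [st, hzx1]) (by simp [st, hzx2])
          (by simp [st, hzs]) rfl (by simp [st, hzl2]) (by simp [st, hzd]) (by simp [st, hzt]) rfl
        refine ⟨base (fSt q T (st k (D₁ ++ [B]) D₂')), hb.of_eq ?_ le_rfl, by simp [st], D₁ ++ [B], D₂', by rw [List.append_assoc]; exact hsplit, hk, rfl⟩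
        simp only [st, oaLoop_append_singleton])
      (t - 1) (base (fSt q T (st (t - 1) [] D'))) ⟨[], D', rfl, by omega, rfl⟩ (by simp [st])
    obtain ⟨R', hR, -, D₁, D₂, hsplit, hk, rfl⟩ := h
    obtain rfl : D₂ = [] := List.eq_nil_of_length_eq_zero hk
    rw [List.append_nil] at hsplit
    subst hsplit
    exact hR
  have hvD := hval D' (fun _ h => h)
  have h5 : Runs (oaLast q) (base (fSt q T (st 0 D' []))) (base (fSt q T { z with inp := encBlocks rest, oacc := pushItem (oaResult N m (C :: D')) z.oacc }))
      (oaLastCost n m (m + (oaLoop N m (C.take m) D' []).2.length)) := by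
    refine (runs_oaLast q hn T hI (st 0 D' []) (hl := C.drop m) hhi hvD.1 hvD.2.2 rfl rfl (by simp [st, hzl2]) (by simp [st, hzd])
      (by simp [st, hzt]) rfl).of_eq ?_ le_rfl
    simp only [st, oaResult, List.nil_append, List.replicate_zero, hztw, hzl1, hzh2, hzc]
  refine (h1.seq (h2.seq (h3.seq (h4.seq h5)))).of_eq rfl ?_
  rw [hvD.2.1, show m + m * D'.length = m * t by rw [← hlen]; ring]
  unfold oaInstCost
  have : (t - 1) * (oaStepCost n m + 2) ≤ t * (oaStepCost n m + 2) := Nat.mul_le_mul_right _ (Nat.sub_le _ _)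
  nlinarith [this]

/-- Cost of the overlap-add pass over `B` instances. [folklore] -/
def oaPassCost (n m t B : ℕ) : ℕ := B * (oaInstCost n m t + 6 * (m * t * (2 * n)) + 12) + 5

/-- **The overlap-add pass.** With the instances (each its `t` arrivals in reverse block order,
coded as head arrival and the rest) concatenated in `IN`, `t` in `T1`, the pass empties `IN` and
puts the codes of `oaResult` of every instance (that is `overlapAdd` of the instance in block
order, `oaResult_reverse`) on top of `OUT`. [folklore] -/
theorem runs_oaPass {N n m t : ℕ} (hn : (encodeNat N).length + 1 ≤ n) (hmn : (encodeNat m).length ≤ n)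
    (htn : (encodeNat t).length ≤ n) (T : Regs β) (hI : OAInv q N m T)
    {insts : List (List ℕ × List (List ℕ))} (hI1 : ∀ p ∈ insts, ∀ B ∈ p.1 :: p.2, B.length = 2 * m ∧ ∀ a ∈ B, a < N)
    (hI2 : ∀ p ∈ insts, p.2.length + 1 = t) (hold twacc : List Bool) (e : List Bool) (he : e = []) :
    Runs (oaPass q) (base (fSt q T ⟨encBlocks (insts.flatMap fun p => p.1 :: p.2), hold, [], [], [], twacc, encodeNat t, [], [], [], [], [], e, [], [], []⟩))
      (base (Function.update (fSt q T ⟨[], hold, [], [], [], twacc, encodeNat t, [], [], [], [], [], e, [], [], []⟩) (q .OUT)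
        (encBlocks (insts.map fun p => oaResult N m (p.1 :: p.2)) ++ T (q .OUT))))
      (oaPassCost n m t insts.length) := by
  have hq : ∀ {i j : FReg}, i ≠ j → q i ≠ q j := fun h => q.injective.ne h
  have hW : T (q (.n (.v .W))) = [] := hI.2.2.2.2.2.2.1
  subst he
  let zOf : List (List ℕ × List (List ℕ)) → List (List ℕ × List (List ℕ)) → FSlots := fun done l =>
    ⟨encBlocks (l.flatMap fun p => p.1 :: p.2), hold, [], [], [], twacc, encodeNat t, [], [], [],
      outRev ((done.map fun p => oaResult N m (p.1 :: p.2)).map encVec), [], [], [], [], []⟩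
  have hloop := runs_streamLoop (L := Sum.inr (q .IN)) (w := vr (rVF q) .W) (by simp [hq]) (body := oaInstance q)
    (fun l => encBlocks (l.flatMap fun p => p.1 :: p.2)) rfl
    (fun a l => by rw [List.flatMap_cons, List.cons_append]; exact encList_cons_ne_nil (encVec a.1) _)
    (fun l R => ∃ done, done ++ l = insts ∧ R = base (fSt q T (zOf done l))) (fun _ => oaInstCost n m t)
    (by
      rintro p l R ⟨done, hdl, rfl⟩ - -
      have hpmem : p ∈ insts := by rw [← hdl]; simp
      have hB := runs_oaInstance q hn hmn htn T hI (zOf done (p :: l)) (C := p.1) (D' := p.2)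
        (rest := l.flatMap fun p => p.1 :: p.2) (hI1 p hpmem) (hI2 p hpmem)
        (by simp only [zOf, List.flatMap_cons, List.cons_append]) rfl rfl rfl rfl rfl rfl rfl rfl rfl rfl rfl
      have heq : base (fSt q T { zOf done (p :: l) with inp := encBlocks (l.flatMap fun p => p.1 :: p.2), oacc := pushItem (oaResult N m (p.1 :: p.2)) (zOf done (p :: l)).oacc }) = base (fSt q T (zOf (done ++ [p]) l)) := by
        simp only [zOf]
        rw [List.map_append, List.map_singleton, outRev_map_encVec_append]
      refine ⟨_, hB.of_eq heq le_rfl, by simp [zOf], ?_, done ++ [p], by rw [List.append_assoc]; exact hdl, rfl⟩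
      exact (fSt_v q T _ (by decide) (by decide) (by decide) (by decide)).trans hW)
    insts (base (fSt q T (zOf [] insts))) ⟨[], rfl, rfl⟩ (by simp [zOf])
    ((fSt_v q T _ (by decide) (by decide) (by decide) (by decide)).trans hW)
  obtain ⟨R', hl, -, -, done, hdone, rfl⟩ := hloop
  rw [List.append_nil] at hdone
  subst hdone
  have hstart : zOf [] done = ⟨encBlocks (done.flatMap fun p => p.1 :: p.2), hold, [], [], [], twacc, encodeNat t, [], [], [], [], [], [], [], [], []⟩ := by
    simp only [zOf, List.map_nil, outRev_nil]
  rw [hstart] at hl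
  set out := done.map fun p => oaResult N m (p.1 :: p.2) with hout
  have hend : zOf done [] = ⟨[], hold, [], [], [], twacc, encodeNat t, [], [], [], outRev (out.map encVec), [], [], [], [], []⟩ := by
    simp only [zOf, List.flatMap_nil, encBlocks_nil, hout]
  rw [hend] at hl
  -- lengths
  have hov : ∀ c ∈ out, c.length = 2 * (m * t / 2) + (m * t) % 2 ∧ ∀ a ∈ c, a < N := by
    intro c hc
    rw [hout, List.mem_map] at hc
    obtain ⟨p, hp, rfl⟩ := hc
    have hC := hI1 p hp p.1 (by simp)
    have hN : 0 < N ∨ m = 0 := by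
      rcases h : p.1 with _ | ⟨a, _⟩
      · right; have := hC.1; rw [h] at this; simp at this; omega
      · left; exact (Nat.zero_le a).trans_lt (hC.2 a (by simp [h]))
    have hlo : (p.1.take m).length = m ∧ ∀ a ∈ p.1.take m, a < N :=
      ⟨by rw [List.length_take, hC.1]; omega, fun a ha => hC.2 a (List.mem_of_mem_take ha)⟩
    rcases hN with hN | hm
    · have hv := oaLoop_valid hN (p.1.take m) p.2 [] hlo (fun B hB => hI1 p hp B (by simp [hB])) (by simp)
      rw [oaResult]
      refine ⟨?_, fun a ha => ?_⟩
      · rw [List.length_append, length_vsubMod, hv.1.1, List.length_drop, hC.1, hv.2.1, List.length_nil, zero_add,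
          show 2 * m - m = m by omega, min_self, show m + m * p.2.length = m * t by rw [← hI2 p hp]; ring]; omega
      · rw [List.mem_append] at ha
        rcases ha with ha | ha
        · exact lt_of_mem_vsubMod hN ha
        · exact hv.2.2 a ha
    · subst hm
      have key : ∀ (D₁ : List (List ℕ)) (lp acc : List ℕ), lp = [] → acc = [] → (∀ B ∈ D₁, B ∈ p.2) → oaLoop N 0 lp D₁ acc = ([], []) := by
        intro D₁; induction D₁ with
        | nil => intro lp acc h1 h2 _; simp [oaLoop, h1, h2]
        | cons B D₁ ih =>
          intro lp acc h1 h2 hs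
          rw [oaLoop]
          have hB : B = [] := List.eq_nil_of_length_eq_zero (by have := (hI1 p hp B (by simp [hs B (by simp)])).1; omega)
          exact ih _ _ rfl (by subst h1; subst h2; subst hB; simp [vaddMod]) (fun B' hB' => hs B' (by simp [hB']))
      have hp1 : p.1 = [] := List.eq_nil_of_length_eq_zero (by have := hC.1; omega)
      rw [oaResult, key p.2 _ _ (by simp [hp1]) rfl (fun _ h => h)]
      simp [hp1, vsubMod]
  have hlout : out.length = done.length := by rw [hout, List.length_map]
  have hlo : (outRev (out.map encVec)).length ≤ done.length * (2 * (m * t * (2 * n)) + 2) := by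
    rw [← reverse_encBlocks, List.length_reverse]
    unfold encBlocks
    rw [length_encList, List.map_map]
    have : ∀ x ∈ out.map ((fun a : List Bool => 2 * a.length + 2) ∘ encVec), x ≤ 2 * (m * t * (2 * n)) + 2 := by
      intro x hx; rw [List.mem_map] at hx; obtain ⟨u, hu, rfl⟩ := hx
      have h1 := length_encVec_le_of_lt (hov u hu).2 hn
      have h2 : u.length = m * t := by rw [(hov u hu).1]; omega
      rw [h2] at h1; simp only [Function.comp_apply]; omega
    have hs := List.sum_le_card_nsmul _ _ this
    rwa [List.length_map, hlout, smul_eq_mul] at hs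
  have hp := runs_opour (a := q .OACC) (b := q .OUT) (hq (by decide))
    (fSt q T ⟨[], hold, [], [], [], twacc, encodeNat t, [], [], [], outRev (out.map encVec), [], [], [], [], []⟩)
  refine (hl.seq hp).of_eq ?_ ?_
  · simp only [fSt_OACC, fSt_OUT, update_fSt_OACC, reverse_outRev]
    rfl
  · simp only [List.map_const', List.sum_replicate, smul_eq_mul, fSt_OACC]
    unfold oaPassCost
    have e3 : done.length * (2 * (m * t * (2 * n)) + 2) = 2 * (done.length * (m * t * (2 * n))) + 2 * done.length := by ring
    rw [e3] at hlo
    nlinarith [hlo]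

end Com

end Literature.Computability.Complexity
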